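import Summits.QuantumFields.YangMills.Theorems.UnitScaleTiltSmoothLiftInterpDefs
import HarnessLib

/-!
# Route `UnitScaleTilt`, crux K1 child «MinimiserStabilityRegPr» (stmt-QuantumFields-19200), stub `stub_smoothLift` (G-K1a-2′) —
# DEFINITIONS for the loop bookkeeping of the smooth interpolation: sites at integer offsets from a block centre, the model potential of
# an abstract curvature tensor, and the list of exponents read along a word

Fleet seat `ym-ust-19200-p2` (gen 0).  The consistency `‖V(c) − avg(interp V)(c)‖ = O(|F|² + |∇F|)` of the interpolation
(`UnitScaleTiltSmoothLiftInterpDefs`) is computed loop by loop: inside a block, the transport of `interp V` along a lattice word is a product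
of exponentials of the model potential read at the successive integer offsets from the block centre.  This file only DEFINES that
bookkeeping (objects the route posits; estimates in the sibling proof files):
* `siteAt y e` — the fine site at integer offset `e` from the centre `emb y` of `B(y)` ([Balaban1987RG1] (0.3): `x = y + Σ δ n_μ e_μ`);
* `potAt F e λ = (2L²)⁻¹ Σ_ρ e_ρ F_{ρλ}` — the symmetric-gauge potential of an abstract curvature tensor `F : Fin d → Fin d → M₂(ℂ)` at
  offset `e` (for `F = curv V y` and `e` the centred offset of `x ∈ B(y)` this is `pot V x λ`);
* `stepExps F e w` — the exponents `±potAt F (source) λ` of the steps of the word `w` walked from offset `e` (`+` forward, `−` backward).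
[cite: Balaban1987RG1, (0.3)-(0.4) p.252; King1986, (A.5) p.676]
-/

noncomputable section

open scoped Matrix.Norms.L2Operator BigOperators

namespace Summit.QuantumFields.YangMills.Theorems.SmoothLiftInterp

open Literature.MathematicalPhysics.QuantumFieldTheory.Balaban1983to89
open T4Continuum AveragingRT

variable {P : Params} {j : ℕ}

/-- **THE FINE SITE AT INTEGER OFFSET `e` FROM THE CENTRE OF THE BLOCK `B(y)`**: `emb y + e` coordinatewise ("x − y = Σ_μ δ n_μ e_μ",
[Balaban1987RG1] p. 252). [cite: Balaban1987RG1, (0.3) p.252] -/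
def siteAt (y : Site P (j+1)) (e : Fin P.d → ℤ) : Site P j :=
  fun ν => emb y ν + ((e ν : ℤ) : ZMod (P.sitesPerDir j))

/-- Coordinates of `siteAt`. [folklore] -/
theorem siteAt_apply (y : Site P (j+1)) (e : Fin P.d → ℤ) (ν : Fin P.d) :
    siteAt y e ν = emb y ν + ((e ν : ℤ) : ZMod (P.sitesPerDir j)) := rfl

/-- The offset `0` is the centre. [folklore] -/
theorem siteAt_zero (y : Site P (j+1)) : siteAt y (0 : Fin P.d → ℤ) = emb y := by
  funext ν; simp [siteAt]

/-- **THE SYMMETRIC-GAUGE POTENTIAL OF AN ABSTRACT CURVATURE TENSOR** `F` at the integer offset `e`: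
`potAt F e λ = (2L²)⁻¹ Σ_ρ e_ρ F_{ρλ}`. [cite: King1986, (A.5) p.676] -/
def potAt (P : Params) (F : Fin P.d → Fin P.d → Matrix (Fin 2) (Fin 2) ℂ) (e : Fin P.d → ℤ) (μ : Fin P.d) : Matrix (Fin 2) (Fin 2) ℂ :=
  (1 / (2 * (P.L : ℝ) ^ 2)) • ∑ ρ : Fin P.d, ((e ρ : ℤ) : ℝ) • F ρ μ

/-- **THE EXPONENTS ALONG A WORD**: walking the word `w` from the offset `e`, a forward letter `+e_λ` at offset `e` contributes
`potAt F e λ` and moves to `e + e_λ`; a backward letter `−e_λ` contributes `−potAt F (e − e_λ) λ` (the bond `⟨e − e_λ, λ⟩` traversed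
backwards) and moves to `e − e_λ`. [cite: Balaban1987RG1, (0.4) p.253] -/
def stepExps (P : Params) (F : Fin P.d → Fin P.d → Matrix (Fin 2) (Fin 2) ℂ) : (Fin P.d → ℤ) → List (Letter P.d) → List (Matrix (Fin 2) (Fin 2) ℂ)
  | _, [] => []
  | e, (μ, true) :: w => potAt P F e μ :: stepExps P F (e + Pi.single μ 1) w
  | e, (μ, false) :: w => -potAt P F (e - Pi.single μ 1) μ :: stepExps P F (e - Pi.single μ 1) w

/-- No letters, no exponents. [folklore] -/
@[simp] theorem stepExps_nil (F : Fin P.d → Fin P.d → Matrix (Fin 2) (Fin 2) ℂ) (e : Fin P.d → ℤ) : stepExps P F e [] = [] := rfl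

/-- A forward letter. [folklore] -/
@[simp] theorem stepExps_cons_true (F : Fin P.d → Fin P.d → Matrix (Fin 2) (Fin 2) ℂ) (e : Fin P.d → ℤ) (μ : Fin P.d)
    (w : List (Letter P.d)) : stepExps P F e ((μ, true) :: w) = potAt P F e μ :: stepExps P F (e + Pi.single μ 1) w := rfl

/-- A backward letter. [folklore] -/
@[simp] theorem stepExps_cons_false (F : Fin P.d → Fin P.d → Matrix (Fin 2) (Fin 2) ℂ) (e : Fin P.d → ℤ) (μ : Fin P.d)
    (w : List (Letter P.d)) :
    stepExps P F e ((μ, false) :: w) = -potAt P F (e - Pi.single μ 1) μ :: stepExps P F (e - Pi.single μ 1) w := rfl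

/-- The number of exponents is the length of the word. [folklore] -/
theorem length_stepExps (F : Fin P.d → Fin P.d → Matrix (Fin 2) (Fin 2) ℂ) :
    ∀ (e : Fin P.d → ℤ) (w : List (Letter P.d)), (stepExps P F e w).length = w.length
  | _, [] => rfl
  | e, (μ, true) :: w => by rw [stepExps_cons_true, List.length_cons, List.length_cons, length_stepExps F _ w]
  | e, (μ, false) :: w => by rw [stepExps_cons_false, List.length_cons, List.length_cons, length_stepExps F _ w]

end Summit.QuantumFields.YangMills.Theorems.SmoothLiftInterp

end
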